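import Literature.Analysis.TotalPositivity.PolyaFrequencySmoothingLimit
import Literature.Analysis.Complex.HutchinsonMultiplierLimit
import HarnessLib

/-!
# The reversed Jensen polynomials of `1/(∫e^{−st}Λ)` are real-rooted (Schoenberg 1951,
necessity half, step N3c)

Trunk `Literature/Analysis/TotalPositivity`, fourteenth proofs file accompanying
`PolyaFrequencyFunctions.lean` (the named fact `schoenberg1951_pf_laplace`).  Let `Λ` be a Pólya
frequency function, `T = Σ_k c_k H_k` its convolution transform on polynomials
(`c_k = ∫ (−t)^k Λ`, PolyaFrequencyPolynomials.lean) and `d` the binomial inverse of `c`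
(`Σ_{i+j=k} C(k,i) c_i d_j = δ_{k0}`, i.e. `d_k/k!` are the Taylor coefficients of
`Ψ = 1/∫e^{−st}Λ(t)dt`).  Then for every `n` the polynomial

> `q_n = Σ_k d_k H_k (X^n) = Σ_k C(n,k) d_k X^{n−k}` (the inverse transform of `X^n`, i.e. the
> reversed `n`-th Jensen polynomial of `Ψ`) has `n` real roots counted with multiplicity

(`IsPolyaFrequencyFun.card_roots_inverseTransform_X_pow`).  This is the real-rootedness statement
from which the Pólya–Schur/Laguerre–Pólya theory produces the form (7) of `Ψ`
[Schoenberg1951, §§8–9; Karlin1968, Ch. 7 §3].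

Proof: `T ∘ S = id` on polynomials of degree `≤ n` (`hasseSum_comp` + the inverse relation);
`g_N = ∏_{j<n} (X − j/(N+1))` has `n` distinct real roots and alternates strictly at `n + 1`
points (`exists_alternation_of_prod_X_sub_C`), and `g_N = T(S g_N)`, so by the variation
diminishing property of `T` (`no_alternation_hasseSum`) `S g_N` has at least `n` distinct real
roots, i.e. is real-rooted; `S g_N → S(X^n) = q_n` coefficientwise, and the number of real roots
is upper semicontinuous at fixed degree
(`Literature.Analysis.Complex.LaguerreCZDS.le_card_roots_of_tendsto`).

## References

* I. J. Schoenberg, *On Pólya frequency functions. I*, J. Analyse Math. 1 (1951) 331–374, §§8–9.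
  [Schoenberg1951]
* S. Karlin, *Total Positivity* I (1968), Ch. 7 §3. [Karlin1968]
* G. Pólya, I. Schur, *Über zwei Arten von Faktorenfolgen*, J. reine angew. Math. 144 (1914).
  [folklore]
-/

noncomputable section

open MeasureTheory Set Filter Finset Polynomial
open scoped Topology Polynomial

namespace Literature.Analysis.TotalPositivity

/-! ### `T ∘ S = id` -/

/-- **The transform inverts its binomial inverse**: if `Σ_{i+j=k} C(k,i) c_i d_j = δ_{k0}` then
`Σ_i c_i H_i (Σ_j d_j H_j g) = g` for `deg g ≤ n`. [folklore] -/
theorem hasseSum_hasseSum_inverse {c d : ℕ → ℝ}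
    (hd : ∀ k, ∑ p ∈ Finset.antidiagonal k, ((k.choose p.1 : ℕ) : ℝ) * c p.1 * d p.2 =
      if k = 0 then 1 else 0) {n : ℕ} {g : ℝ[X]} (hg : g.natDegree ≤ n) :
    ∑ i ∈ Finset.range (n + 1), c i • Polynomial.hasseDeriv i
        (∑ j ∈ Finset.range (n + 1), d j • Polynomial.hasseDeriv j g) = g := by
  rw [hasseSum_comp hg]
  simp only [hd, ite_smul, one_smul, zero_smul, Finset.sum_ite_eq', Finset.mem_range,
    Nat.succ_pos, if_true, Polynomial.hasseDeriv_zero']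

/-- `d₀ c₀ = 1` for a binomial inverse. [folklore] -/
theorem inverse_zero_mul {c d : ℕ → ℝ}
    (hd : ∀ k, ∑ p ∈ Finset.antidiagonal k, ((k.choose p.1 : ℕ) : ℝ) * c p.1 * d p.2 =
      if k = 0 then 1 else 0) : c 0 * d 0 = 1 := by
  have h := hd 0
  simpa using h

/-! ### Coefficientwise continuity of `∏ (X − ρ_j)` -/

/-- The coefficients of `∏_j (X − ρ_j)` depend continuously on the roots. [folklore] -/
theorem tendsto_coeff_prod_X_sub_C :
    ∀ (n : ℕ) (ρ : ℕ → Fin n → ℝ) (ρ₀ : Fin n → ℝ),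
      (∀ j, Tendsto (fun N => ρ N j) atTop (𝓝 (ρ₀ j))) →
      ∀ k, Tendsto (fun N => (∏ j, (Polynomial.X - Polynomial.C (ρ N j))).coeff k) atTop
        (𝓝 ((∏ j, (Polynomial.X - Polynomial.C (ρ₀ j))).coeff k)) := by
  intro n
  induction n with
  | zero =>
    intro ρ ρ₀ _ k
    simp
  | succ n ih =>
    intro ρ ρ₀ hρ k
    have hIH := ih (fun N j => ρ N j.succ) (fun j => ρ₀ j.succ) (fun j => hρ j.succ)
    have hsplit : ∀ σ : Fin (n + 1) → ℝ, (∏ j, (Polynomial.X - Polynomial.C (σ j))) =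
        (Polynomial.X - Polynomial.C (σ 0)) * ∏ j : Fin n, (Polynomial.X - Polynomial.C (σ j.succ)) :=
      fun σ => Fin.prod_univ_succ _
    have hcoeff : ∀ (σ : Fin (n + 1) → ℝ) (k : ℕ),
        (∏ j, (Polynomial.X - Polynomial.C (σ j))).coeff k =
        (if k = 0 then 0 else (∏ j : Fin n, (Polynomial.X - Polynomial.C (σ j.succ))).coeff (k - 1)) -
          σ 0 * (∏ j : Fin n, (Polynomial.X - Polynomial.C (σ j.succ))).coeff k := by
      intro σ k
      rw [hsplit, sub_mul, Polynomial.coeff_sub, Polynomial.coeff_C_mul]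
      congr 1
      rcases k with _ | k
      · simp
      · simp [Polynomial.coeff_X_mul]
    simp only [hcoeff]
    refine Tendsto.sub ?_ ((hρ 0).mul (hIH k))
    rcases k with _ | k
    · simp
    · simpa using hIH k

/-! ### Real-rootedness of the inverse transform of `X^n` -/

/-- **The inverse transform of `X^n` is real-rooted** (the reversed Jensen polynomials of
`Ψ = 1/∫e^{−st}Λ` are hyperbolic): for a Pólya frequency function `Λ`, `c_k = ∫(−t)^kΛ`, `d` the
binomial inverse of `c`, and every `n`, the polynomial `q_n = Σ_{k≤n} d_k H_k (X^n)` has degree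
`n` and `n` real roots counted with multiplicity.
[cite: Schoenberg1951, §§8–9] [cite: Karlin1968, Ch. 7 §3] -/
theorem IsPolyaFrequencyFun.card_roots_inverseTransform_X_pow {Λ : ℝ → ℝ} (h : IsPolyaFrequencyFun Λ)
    {c : ℕ → ℝ} (hc : ∀ k, c k = ∫ t, (-t) ^ k * Λ t) {d : ℕ → ℝ}
    (hd : ∀ k, ∑ p ∈ Finset.antidiagonal k, ((k.choose p.1 : ℕ) : ℝ) * c p.1 * d p.2 =
      if k = 0 then 1 else 0) (n : ℕ) :
    (∑ k ∈ Finset.range (n + 1), d k • Polynomial.hasseDeriv k (Polynomial.X ^ n : ℝ[X])).natDegree = n ∧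
      Multiset.card (∑ k ∈ Finset.range (n + 1),
        d k • Polynomial.hasseDeriv k (Polynomial.X ^ n : ℝ[X])).roots = n := by
  classical
  set S : ℝ[X] → ℝ[X] := fun g => ∑ k ∈ Finset.range (n + 1), d k • Polynomial.hasseDeriv k g with hS
  set T : ℝ[X] → ℝ[X] := fun g => ∑ k ∈ Finset.range (n + 1), c k • Polynomial.hasseDeriv k g with hT
  set q : ℝ[X] := S (Polynomial.X ^ n) with hq
  have hd0 : d 0 ≠ 0 := by
    have := inverse_zero_mul hd
    intro h0
    rw [h0, mul_zero] at this
    exact zero_ne_one this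
  -- degree of `q`
  have hXn : (Polynomial.X ^ n : ℝ[X]).natDegree ≤ n := Polynomial.natDegree_X_pow_le n
  have hqdeg_le : q.natDegree ≤ n := natDegree_hasseSum_le hXn
  have hqcoeff : q.coeff n = d 0 := by
    rw [hq, hS]
    simp only [Polynomial.finsetSum_coeff, Polynomial.coeff_smul, smul_eq_mul]
    rw [Finset.sum_eq_single 0]
    · simp
    · intro k hk hk0
      have hdeg : (Polynomial.hasseDeriv k (Polynomial.X ^ n : ℝ[X])).natDegree < n ∨ n = 0 := by
        have h1 := Polynomial.natDegree_hasseDeriv_le (Polynomial.X ^ n : ℝ[X]) k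
        rw [Polynomial.natDegree_X_pow] at h1
        rcases Nat.eq_zero_or_pos n with hn | hn
        · exact Or.inr hn
        · left
          have : 0 < k := Nat.pos_of_ne_zero hk0
          omega
      rcases hdeg with hdeg | hn
      · rw [Polynomial.coeff_eq_zero_of_natDegree_lt hdeg, mul_zero]
      · subst hn
        simp only [Finset.mem_range] at hk
        omega
    · simp
  have hqdeg : q.natDegree = n := Polynomial.natDegree_eq_of_le_of_coeff_ne_zero hqdeg_le (by
    rw [hqcoeff]; exact hd0)
  have hq0 : q ≠ 0 := by
    intro h0
    have := hqcoeff
    rw [h0, Polynomial.coeff_zero] at this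
    exact hd0 this.symm
  refine ⟨hqdeg, le_antisymm ((Polynomial.card_roots' q).trans hqdeg.le) ?_⟩
  -- the approximating polynomials with distinct real roots
  set ρ : ℕ → Fin n → ℝ := fun N j => ((j : ℕ) : ℝ) / ((N : ℝ) + 1) with hρ
  have hρmono : ∀ N, StrictMono (ρ N) := fun N j j' hjj' => by
    simp only [hρ]
    exact div_lt_div_of_pos_right (by exact_mod_cast hjj') (by positivity)
  set g : ℕ → ℝ[X] := fun N => ∏ j, (Polynomial.X - Polynomial.C (ρ N j)) with hg
  have hgdeg : ∀ N, (g N).natDegree = n := fun N => by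
    show (∏ j, (Polynomial.X - Polynomial.C (ρ N j))).natDegree = n
    rw [Polynomial.natDegree_prod_of_monic Finset.univ _ (fun j _ => Polynomial.monic_X_sub_C _)]
    simp
  have hgmonic : ∀ N, (g N).Monic := fun N =>
    Polynomial.monic_prod_of_monic _ _ fun j _ => Polynomial.monic_X_sub_C _
  set F : ℕ → ℝ[X] := fun N => S (g N) with hF
  have hFdeg : ∀ N, (F N).natDegree ≤ n := fun N => natDegree_hasseSum_le (hgdeg N).le
  have hTF : ∀ N, T (F N) = g N := fun N => hasseSum_hasseSum_inverse hd (hgdeg N).le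
  -- each `F N` has `n` real roots
  have hFroots : ∀ N, n ≤ Multiset.card (F N).roots := by
    intro N
    have hF0 : F N ≠ 0 := by
      intro h0
      have h1 := hTF N
      rw [h0] at h1
      have : T 0 = 0 := by simp [hT]
      rw [this] at h1
      exact (hgmonic N).ne_zero h1.symm
    -- enumerate the distinct real roots of `F N`
    set s : Finset ℝ := (F N).roots.toFinset with hs
    set m : ℕ := s.card with hm
    set r : Fin m ↪o ℝ := s.orderEmbOfFin rfl with hr
    have hrmono : StrictMono r := r.strictMono
    have hroots : ∀ t : ℝ, (F N).eval t = 0 → t ∈ Set.range r := by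
      intro t ht
      rw [hr, Finset.range_orderEmbOfFin, Finset.mem_coe, hs, Multiset.mem_toFinset,
        Polynomial.mem_roots hF0]
      exact ht
    -- alternation of `T (F N) = g N` at `n + 1` points
    obtain ⟨z, hz, hzalt⟩ := exists_alternation_of_prod_X_sub_C (hρmono N) one_ne_zero
    have hgC : Polynomial.C (1 : ℝ) * ∏ j, (Polynomial.X - Polynomial.C (ρ N j)) = T (F N) := by
      rw [Polynomial.C_1, one_mul, hTF N]
    rw [hgC] at hzalt
    -- hence `m ≥ n`
    have hmn : n ≤ m := by
      by_contra hlt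
      push Not at hlt
      -- restrict `z` to the first `m + 2` points
      have hle : m + 2 ≤ n + 1 := by omega
      set z' : Fin (m + 2) → ℝ := fun i => z (Fin.castLE hle i) with hz'
      have hz'mono : StrictMono z' := hz.comp (Fin.strictMono_castLE hle)
      have hcontra := h.no_alternation_hasseSum hc (hFdeg N) hrmono hroots hz'mono
      apply hcontra
      intro i
      have h1 := hzalt ⟨i, by omega⟩
      have e1 : (⟨i, by omega⟩ : Fin n).castSucc = Fin.castLE hle i.castSucc := Fin.ext rfl
      have e2 : (⟨i, by omega⟩ : Fin n).succ = Fin.castLE hle i.succ := Fin.ext rfl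
      rw [e1, e2] at h1
      exact h1
    calc n ≤ m := hmn
      _ = s.card := hm
      _ ≤ Multiset.card (F N).roots := by
          rw [hs]
          exact Multiset.toFinset_card_le _
  -- coefficientwise convergence `F N → q`
  have hcoefS : ∀ (p : ℝ[X]) (k : ℕ), (S p).coeff k =
      ∑ i ∈ Finset.range (n + 1), d i * (((k + i).choose i : ℕ) : ℝ) * p.coeff (k + i) := by
    intro p k
    rw [hS]
    simp only [Polynomial.finsetSum_coeff, Polynomial.coeff_smul, smul_eq_mul,
      Polynomial.hasseDeriv_coeff]
    refine Finset.sum_congr rfl fun i _ => ?_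
    ring
  have hgcoef : ∀ k, Tendsto (fun N => (g N).coeff k) atTop (𝓝 ((Polynomial.X ^ n : ℝ[X]).coeff k)) := by
    have hlim := tendsto_coeff_prod_X_sub_C n ρ (fun _ => 0) (fun j => by
      simp only [hρ]
      exact tendsto_const_nhds.div_atTop (tendsto_natCast_atTop_atTop.atTop_add tendsto_const_nhds))
    intro k
    have hX : (∏ j : Fin n, (Polynomial.X - Polynomial.C ((fun _ => (0 : ℝ)) j))) = Polynomial.X ^ n := by
      simp
    rw [← hX]
    exact hlim k
  have hFcoef : ∀ k, Tendsto (fun N => (F N).coeff k) atTop (𝓝 (q.coeff k)) := by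
    intro k
    simp only [hF, hq, hcoefS]
    exact tendsto_finsetSum _ fun i _ => (hgcoef (k + i)).const_mul _
  exact Literature.Analysis.Complex.LaguerreCZDS.le_card_roots_of_tendsto n n q F hq0 hqdeg hFdeg
    hFcoef hFroots

end Literature.Analysis.TotalPositivity

end
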